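import Summits.CriticalPhenomena.CardyFormulaZ2.Theorems.CardyMagicRigidityPinchResamplingDefsV3
import Literature.Probability.Percolation.ZdFiveArmMonotone
import Literature.Probability.Percolation.FourArmGarbanProofs
import HarnessLib
import Literature.Probability.Percolation.ZdFiveArmUpperBound

/-!
# Stub S6 `stub_fiveArmUpperZ2` of line `pinch-resampling` v3 (crux `NestingRigidity`, stmt-CriticalPhenomena-4835):
# `FiveArmUpperZ2` from the printed five-arm upper bound for critical bond percolation on `ℤ²`

The registered stub `stub_fiveArmUpperZ2 : FiveArmUpperZ2` (`Theorems/CardyMagicRigidityPinchResamplingDefsV3.lean`)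
asks for the two-radii five-arm UPPER bound `P_{1/2}(𝒜₅(A_{m,n})) ≤ C (m/n)²` (`m₀ ≤ m ≤ n`) for critical bond
percolation on `ℤ²`, in the tree's cluster form `zdFiveArmClusters` (`Literature/…/ZdFourArmFromFiveArm.lean`).
This is a PUBLISHED theorem absent from the tree (its from-scratch proof needs Kesten's arm separation /
quasi-multiplicativity for five arms on bond `ℤ²`, cf. `fiveArmUpperZ2_of_point_quasiMult` in the audit file
`…NestingRigidityFiveArmZ2Audit.lean`; the tree's `ArmSeparation*` series is site-`𝕋` only).  Following the lead's
NEED-A-PUBLISHED-FACT rule it is vendored here as an inline named fact, to be relocated by the gate to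
`Literature/Probability/Percolation/ZdFiveArmUpperBound.lean`:

* `DuminilCopinManolescuTassion2021_zdFiveArm_upperBound` (NAMED FACT, `def … : Prop`, nothing asserted) — the upper
  half of H. Duminil-Copin, I. Manolescu, V. Tassion, PTRF 181 (2021), Prop. 6.6 (universal arm exponents) at
  cluster weight `q = 1` (= Bernoulli bond percolation on `ℤ²` at `p_c(1) = 1/2`): `P_{1/2}[A_{10101}(r,R)] ≤ C₉ (r/R)²`
  for all `R ≥ r ≥ 1`, the event `A_{10101}(r,R)` rendered by `zdFiveArmClusters r R` exactly as the tree renders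
  van den Berg–Nolin's `𝒜_σ(A_{n₁,n₂})` (docstring of `zdFiveArmClusters`) and Garban's `π₄`, `π₂`
  (`Garban2011_fourArm_multiscale`, `FourArmGarban.lean`);
* `fiveArmUpperZ2_of_upperBound_one_le` (registered anchor) — the printed shape (`∀ R ≥ r ≥ 1`, `C > 0`) gives the
  stub's shape (`∃ C m₀`), with `m₀ = 1`;
* `fiveArmUpperZ2_of_DCMT2021` — **`stub_fiveArmUpperZ2` CONDITIONALLY on the named fact** (trust base: that one name);
* `upperBound_one_le_of_fiveArmUpperZ2`, `fiveArmUpperZ2_iff_upperBound_one_le` — conversely the stub's shape gives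
  back the printed shape (monotonicity of `𝒜₅` in the inner radius, `real_zdFiveArmClusters_mono`, and `P ≤ 1` in the
  bounded regime), so `FiveArmUpperZ2` is EQUIVALENT to the vendored statement: the stub is the printed theorem, neither
  weakened nor strengthened.

Unconditional content: the two shape conversions.  Conditional content: `fiveArmUpperZ2_of_DCMT2021`.
-/

noncomputable section

namespace Summit.CriticalPhenomena.CardyFormulaZ2.Cruxes.NestingRigidity.PinchResampling

open MeasureTheory Literature.Probability.Percolation Literature.Probability.LatticeModels

/-! ### The printed theorem (named fact, to be relocated to `Literature/Probability/Percolation/ZdFiveArmUpperBound.lean`) -/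

/-- **The printed shape implies the stub's shape** (registered anchor of this file): a bound `C (r/R)²` valid for
all `1 ≤ r ≤ R` is a bound valid for all `m₀ ≤ m ≤ n` with `m₀ = 1`. -/
theorem fiveArmUpperZ2_of_upperBound_one_le : (∃ C : ℝ, 0 < C ∧ ∀ r R : ℕ, 1 ≤ r → r ≤ R → (bondPercolation (zdGraph 2) half).real (zdFiveArmClusters r R) ≤ C * ((r : ℝ) / R) ^ 2) → FiveArmUpperZ2 := by
  rintro ⟨C, -, h⟩
  exact ⟨C, 1, h⟩

/-- **Stub S6 conditionally on the printed theorem**: `FiveArmUpperZ2` follows from the named fact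
`DuminilCopinManolescuTassion2021_zdFiveArm_upperBound` (Duminil-Copin–Manolescu–Tassion 2021, Prop. 6.6, upper
bound at `q = 1`).  CONDITIONAL: the trust base is that one name; discharging it (`…_holds`) closes
`stub_fiveArmUpperZ2` by `fiveArmUpperZ2_of_DCMT2021 …_holds`. -/
theorem fiveArmUpperZ2_of_DCMT2021 (h : Literature.Probability.Percolation.DuminilCopinManolescuTassion2021_zdFiveArm_upperBound) :
    FiveArmUpperZ2 :=
  fiveArmUpperZ2_of_upperBound_one_le h

/-- **The stub's shape gives back the printed shape**: from `P(𝒜₅(A_{m,n})) ≤ C (m/n)²` for `m₀ ≤ m ≤ n` one gets a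
positive constant `C' = (max C 0 + 1) m₁²`, `m₁ = max m₀ 1`, working for ALL `1 ≤ r ≤ R`: for `r ≥ m₁` directly; for
`r < m₁ ≤ R` by monotonicity in the inner radius, `P(𝒜₅(A_{r,R})) ≤ P(𝒜₅(A_{m₁,R})) ≤ C (m₁/R)² ≤ C m₁² (r/R)²`
(`real_zdFiveArmClusters_mono`); for `R < m₁` trivially, `P ≤ 1 ≤ m₁² (r/R)²`. -/
theorem upperBound_one_le_of_fiveArmUpperZ2 (h : FiveArmUpperZ2) :
    ∃ C : ℝ, 0 < C ∧ ∀ r R : ℕ, 1 ≤ r → r ≤ R →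
      (bondPercolation (zdGraph 2) half).real (zdFiveArmClusters r R) ≤ C * ((r : ℝ) / R) ^ 2 := by
  obtain ⟨C, m₀, h⟩ := h
  set μ := bondPercolation (zdGraph 2) half with hμ
  set m₁ : ℕ := max m₀ 1 with hm₁
  have hm₁0 : m₀ ≤ m₁ := le_max_left _ _
  have hm₁1 : 1 ≤ m₁ := le_max_right _ _
  have hm₁r : (1 : ℝ) ≤ m₁ := by exact_mod_cast hm₁1
  set D : ℝ := max C 0 with hD
  have hD0 : 0 ≤ D := le_max_right _ _
  have hCD : C ≤ D := le_max_left _ _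
  refine ⟨(D + 1) * (m₁ : ℝ) ^ 2, by positivity, fun r R hr hrR ↦ ?_⟩
  have hr0 : (0 : ℝ) < r := by exact_mod_cast hr
  have hR0 : (0 : ℝ) < R := by exact_mod_cast (show 0 < R by omega)
  set q : ℝ := ((r : ℝ) / R) ^ 2 with hq
  have hq0 : 0 ≤ q := by positivity
  -- the three constants compared
  have hD1 : D ≤ (D + 1) * (m₁ : ℝ) ^ 2 := by nlinarith [one_le_pow₀ (n := 2) hm₁r]
  have hm2 : (m₁ : ℝ) ^ 2 ≤ (D + 1) * (m₁ : ℝ) ^ 2 := by nlinarith [sq_nonneg (m₁ : ℝ)]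
  have hDm : D * (m₁ : ℝ) ^ 2 ≤ (D + 1) * (m₁ : ℝ) ^ 2 := by nlinarith [sq_nonneg (m₁ : ℝ)]
  by_cases hm : m₁ ≤ r
  · -- large inner radius: the stub applies directly
    calc μ.real (zdFiveArmClusters r R) ≤ C * q := h r R (hm₁0.trans hm) hrR
      _ ≤ D * q := mul_le_mul_of_nonneg_right hCD hq0
      _ ≤ (D + 1) * (m₁ : ℝ) ^ 2 * q := mul_le_mul_of_nonneg_right hD1 hq0
  · have hrm : r ≤ m₁ := (not_le.1 hm).le
    by_cases hRm : m₁ ≤ R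
    · -- small inner radius, large outer radius: raise the inner radius to `m₁`
      have hmono : μ.real (zdFiveArmClusters r R) ≤ μ.real (zdFiveArmClusters m₁ R) :=
        real_zdFiveArmClusters_mono half hrm hRm le_rfl
      have hq₁ : ((m₁ : ℝ) / R) ^ 2 ≤ (m₁ : ℝ) ^ 2 * q := by
        rw [hq, ← mul_pow]
        refine pow_le_pow_left₀ (by positivity) ?_ 2
        rw [mul_div_assoc', div_le_div_iff_of_pos_right hR0]
        have hr1 : (1 : ℝ) ≤ r := by exact_mod_cast hr
        nlinarith
      calc μ.real (zdFiveArmClusters r R) ≤ μ.real (zdFiveArmClusters m₁ R) := hmono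
        _ ≤ C * ((m₁ : ℝ) / R) ^ 2 := h m₁ R hm₁0 hRm
        _ ≤ D * ((m₁ : ℝ) / R) ^ 2 := mul_le_mul_of_nonneg_right hCD (by positivity)
        _ ≤ D * ((m₁ : ℝ) ^ 2 * q) := mul_le_mul_of_nonneg_left hq₁ hD0
        _ = D * (m₁ : ℝ) ^ 2 * q := by ring
        _ ≤ (D + 1) * (m₁ : ℝ) ^ 2 * q := mul_le_mul_of_nonneg_right hDm hq0
    · -- small outer radius: probabilities are at most `1 ≤ m₁² (r/R)²`
      have hlt : R < m₁ := not_le.1 hRm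
      have h1 : (1 : ℝ) ≤ (m₁ : ℝ) * ((r : ℝ) / R) := by
        rw [mul_div_assoc', le_div_iff₀ hR0, one_mul]
        have : (R : ℝ) ≤ m₁ := by exact_mod_cast hlt.le
        have hr1 : (1 : ℝ) ≤ r := by exact_mod_cast hr
        nlinarith
      calc μ.real (zdFiveArmClusters r R) ≤ 1 := measureReal_le_one
        _ ≤ ((m₁ : ℝ) * ((r : ℝ) / R)) ^ 2 := one_le_pow₀ h1
        _ = (m₁ : ℝ) ^ 2 * q := by rw [hq, mul_pow]
        _ ≤ (D + 1) * (m₁ : ℝ) ^ 2 * q := mul_le_mul_of_nonneg_right hm2 hq0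

/-- **`FiveArmUpperZ2` is equivalent to the printed statement** (as rendered): the stub neither weakens nor
strengthens Duminil-Copin–Manolescu–Tassion 2021, Prop. 6.6 (upper bound, `q = 1`). -/
theorem fiveArmUpperZ2_iff_upperBound_one_le :
    FiveArmUpperZ2 ↔ Literature.Probability.Percolation.DuminilCopinManolescuTassion2021_zdFiveArm_upperBound :=
  ⟨upperBound_one_le_of_fiveArmUpperZ2, fiveArmUpperZ2_of_DCMT2021⟩

end Summit.CriticalPhenomena.CardyFormulaZ2.Cruxes.NestingRigidity.PinchResampling

end
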